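import Literature.MathematicalPhysics.QuantumManyBody.BoseEinsteinCondensation
import Mathlib.MeasureTheory.Constructions.HaarToSphere
import Mathlib.MeasureTheory.Measure.Lebesgue.VolumeOfBalls
import Mathlib.MeasureTheory.Measure.Haar.InnerProductSpace
import Mathlib.Analysis.InnerProductSpace.Projection.Reflection
import Mathlib.MeasureTheory.Integral.IntervalIntegral.FundThmCalculus
import Mathlib.MeasureTheory.Integral.Prod
import Mathlib.Analysis.SpecialFunctions.Integrals.Basic
import HarnessLib

/-!
# Two radial Fourier integrals on balls of `ℝ³`
# (route `BECSubharmonicContinuation`, helper for item `ContinuationToPeriodicBEC`, stmt-14585)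

For `k ∈ ℝ³ ∖ {0}` and `ϱ ≥ 0`, with `x = |k|ϱ`, this file proves
`∫_{|y| < ϱ} cos(k·y) dy = 4π (sin x − x cos x) / |k|³` (`integral_ball_cos_inner`, the Fourier
transform of the indicator of a ball); the companion `…RadialKernelsNewton.lean` proves
`∫_{|y| < ϱ} cos(k·y) / |y| dy = 4π (1 − cos x) / |k|²` (the truncated Newton kernel).

Proof: a Householder reflection (`Submodule.reflection_sub`) maps `k` to `|k| e₀`, so
`cos(k·y)` becomes `cos(|k| y₀)`; Fubini `ℝ³ = ℝ × ℝ²` along `e₀` (`exists_slabEquiv`,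
`MeasurableEquiv.piFinSuccAbove`); on the slices the disc area `π(ϱ² − t²)`
(`EuclideanSpace.volume_ball_fin_two`) resp. the planar radial integral
`∫_{|w|² < ϱ² − t²} (t² + |w|²)^{-1/2} dw = 2π(ϱ − |t|)` (`integral_fun_norm_addHaar`); then
one-variable calculus. These are the classical formulas
`∫_{B_ϱ} e^{ik·y} f(|y|) dy = (4π/|k|) ∫₀^ϱ f(s) s sin(|k|s) ds` (Stein–Weiss, *Introduction to
Fourier Analysis on Euclidean Spaces*, Ch. IV Thm 3.3, `n = 3`) for `f = 1` and `f = 1/s`.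
Everything here is folklore and fully proved; no named facts.
-/

noncomputable section

namespace Summit.AtomisticToContinuum.BoseEinsteinCondensation.Theorems.SubharmonicContinuation

open MeasureTheory Filter Set WithLp Metric
open scoped ENNReal NNReal RealInnerProductSpace
open Literature.MathematicalPhysics.QuantumManyBody.BoseGas (Space)

section Slab

/-- **The slab splitting `ℝ³ ≃ ℝ × ℝ²`**: there is a measurable equivalence
`e : ℝ³ ≃ᵐ ℝ × ℝ²` preserving Lebesgue measure whose inverse sends `(t, w)` to the point with
`0`-th coordinate `t` and norm `√(t² + |w|²)` (namely `y ↦ (y₀, (y₁, y₂))`: Mathlib's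
`MeasurableEquiv.piFinSuccAbove` at the index `0`, conjugated by the identifications
`EuclideanSpace ℝ (Fin n) ≃ (Fin n → ℝ)`). [folklore] -/
theorem exists_slabEquiv : ∃ e : Space ≃ᵐ ℝ × EuclideanSpace ℝ (Fin 2),
    MeasurePreserving e volume volume ∧ ∀ (t : ℝ) (w : EuclideanSpace ℝ (Fin 2)),
      e.symm (t, w) 0 = t ∧ ‖e.symm (t, w)‖ ^ 2 = t ^ 2 + ‖w‖ ^ 2 := by
  set e : Space ≃ᵐ ℝ × EuclideanSpace ℝ (Fin 2) := MeasurableEquiv.trans (MeasurableEquiv.trans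
    (MeasurableEquiv.symm (MeasurableEquiv.toLp 2 (Fin 3 → ℝ)))
    (MeasurableEquiv.piFinSuccAbove (fun _ : Fin 3 => ℝ) 0))
    (MeasurableEquiv.prodCongr (MeasurableEquiv.refl ℝ) (MeasurableEquiv.toLp 2 (Fin 2 → ℝ)))
    with he
  have htoLp : ∀ (t : ℝ) (w : EuclideanSpace ℝ (Fin 2)), e (toLp 2 ![t, w 0, w 1]) = (t, w) := by
    intro t w
    refine Prod.ext rfl ?_
    ext j
    fin_cases j <;> rfl
  have hsymm : ∀ (t : ℝ) (w : EuclideanSpace ℝ (Fin 2)), e.symm (t, w) = toLp 2 ![t, w 0, w 1] := by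
    intro t w
    apply e.injective
    rw [MeasurableEquiv.apply_symm_apply, htoLp]
  refine ⟨e, ?_, fun t w => ⟨by rw [hsymm]; rfl, ?_⟩⟩
  · have h1 : MeasurePreserving (MeasurableEquiv.toLp 2 (Fin 3 → ℝ)).symm volume volume :=
      EuclideanSpace.volume_preserving_symm_measurableEquiv_toLp (Fin 3)
    have h2 : MeasurePreserving (MeasurableEquiv.piFinSuccAbove (fun _ : Fin 3 => ℝ) 0) volume
        volume :=
      volume_preserving_piFinSuccAbove (fun _ => ℝ) 0
    have h3 : MeasurePreserving
        (MeasurableEquiv.prodCongr (MeasurableEquiv.refl ℝ) (MeasurableEquiv.toLp 2 (Fin 2 → ℝ)))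
        volume volume :=
      (MeasurePreserving.id volume).prod (PiLp.volume_preserving_toLp (Fin 2))
    exact (h1.trans h2).trans h3
  · rw [hsymm, EuclideanSpace.norm_eq, EuclideanSpace.norm_eq,
      Real.sq_sqrt (Finset.sum_nonneg fun _ _ => by positivity),
      Real.sq_sqrt (Finset.sum_nonneg fun _ _ => by positivity), Fin.sum_univ_three, Fin.sum_univ_two]
    simp [Real.norm_eq_abs, sq_abs, add_assoc]

/-- **Fubini along a measure-preserving splitting**: `∫ G dy = ∫ dt ∫ dw G(e⁻¹(t, w))` for
integrable `G : ℝ³ → ℝ`. [folklore] -/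
theorem integral_eq_integral_integral_symm {e : Space ≃ᵐ ℝ × EuclideanSpace ℝ (Fin 2)}
    (he : MeasurePreserving e volume volume) {G : Space → ℝ} (hG : Integrable G) :
    ∫ y, G y = ∫ t : ℝ, ∫ w : EuclideanSpace ℝ (Fin 2), G (e.symm (t, w)) := by
  have hmp : MeasurePreserving e.symm volume volume := he.symm _
  rw [← hmp.integral_comp' (g := G)]
  exact integral_prod _ ((hmp.integrable_comp_emb e.symm.measurableEmbedding).2 hG)

end Slab

section Reflection

/-- **Reduction to an axis**: for `k ≠ 0` there is a linear isometry `T` of `ℝ³` with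
`⟪k, y⟫ = |k| (T y)₀` for all `y` (the Householder reflection exchanging `k/|k|… ` and `e₀`).
[folklore] -/
theorem exists_linearIsometryEquiv_inner_eq (k : Space) :
    ∃ T : Space ≃ₗᵢ[ℝ] Space, ∀ y : Space, ⟪k, y⟫ = ‖k‖ * (T y) 0 := by
  set e : Space := EuclideanSpace.single 0 (1 : ℝ) with he
  have hke : ‖k‖ = ‖(‖k‖ : ℝ) • e‖ := by
    rw [norm_smul, he, PiLp.norm_single, norm_one, mul_one, Real.norm_of_nonneg (norm_nonneg _)]
  refine ⟨Submodule.reflection (ℝ ∙ (k - ‖k‖ • e))ᗮ, fun y => ?_⟩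
  set T := Submodule.reflection (ℝ ∙ (k - ‖k‖ • e))ᗮ with hT
  have hTk : T k = ‖k‖ • e := Submodule.reflection_sub hke
  calc ⟪k, y⟫ = ⟪T k, T y⟫ := (T.inner_map_map k y).symm
    _ = ‖k‖ * (T y) 0 := by
        rw [hTk, real_inner_smul_left, he, EuclideanSpace.inner_single_left, map_one, one_mul]

/-- **Rotating the phase to the axis**: for any `F`,
`∫_{|y|<ϱ} F(k·y, |y|) dy = ∫_{|y|<ϱ} F(|k| y₀, |y|) dy`. [folklore] -/
theorem setIntegral_ball_inner_eq (k : Space) (ϱ : ℝ) (F : ℝ → ℝ → ℝ) :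
    ∫ y in ball (0 : Space) ϱ, F ⟪k, y⟫ ‖y‖ = ∫ y in ball (0 : Space) ϱ, F (‖k‖ * y 0) ‖y‖ := by
  obtain ⟨T, hT⟩ := exists_linearIsometryEquiv_inner_eq k
  have hmp : MeasurePreserving T volume volume := T.measurePreserving
  have hpre : T ⁻¹' ball (0 : Space) ϱ = ball 0 ϱ := by
    rw [LinearIsometryEquiv.preimage_ball, map_zero]
  have h := hmp.setIntegral_preimage_emb T.toMeasurableEquiv.measurableEmbedding
    (fun y => F (‖k‖ * y 0) ‖y‖) (ball (0 : Space) ϱ)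
  rw [hpre] at h
  rw [← h]
  refine setIntegral_congr_fun measurableSet_ball fun y _ => ?_
  simp only [hT y, LinearIsometryEquiv.norm_map]

end Reflection

section Slices

/-- Membership in the ball through the slab coordinates: if `‖v‖² = t² + |w|²` then
`v ∈ B_ϱ ↔ t² + |w|² < ϱ²` (`ϱ ≥ 0`). [folklore] -/
theorem mem_ball_iff_of_norm_sq {ϱ : ℝ} (hϱ : 0 ≤ ϱ) {v : Space} {t : ℝ}
    {w : EuclideanSpace ℝ (Fin 2)} (hv : ‖v‖ ^ 2 = t ^ 2 + ‖w‖ ^ 2) :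
    v ∈ ball (0 : Space) ϱ ↔ t ^ 2 + ‖w‖ ^ 2 < ϱ ^ 2 := by
  rw [mem_ball_zero_iff, ← hv, sq_lt_sq, abs_of_nonneg (norm_nonneg _), abs_of_nonneg hϱ]

/-- The slice `{w : t² + |w|² < ϱ²}` of the ball is the disc of radius `√(ϱ² − t²)` (empty when
`ϱ² ≤ t²`). [folklore] -/
theorem sliceSet_eq_ball (ϱ t : ℝ) :
    {w : EuclideanSpace ℝ (Fin 2) | t ^ 2 + ‖w‖ ^ 2 < ϱ ^ 2} = ball (0 : EuclideanSpace ℝ (Fin 2)) (Real.sqrt (ϱ ^ 2 - t ^ 2)) := by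
  ext w
  rw [mem_setOf_eq, mem_ball_zero_iff, Real.lt_sqrt (norm_nonneg _)]
  constructor <;> intro h <;> linarith

/-- … and empty when `ϱ² ≤ t²`. [folklore] -/
theorem sliceSet_eq_empty {ϱ t : ℝ} (ht : ϱ ^ 2 ≤ t ^ 2) :
    {w : EuclideanSpace ℝ (Fin 2) | t ^ 2 + ‖w‖ ^ 2 < ϱ ^ 2} = ∅ := by
  ext w
  simp only [mem_setOf_eq, mem_empty_iff_false, iff_false, not_lt]
  exact le_add_of_le_of_nonneg ht (sq_nonneg _)

/-- The slice set is measurable. [folklore] -/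
theorem measurableSet_sliceSet (ϱ t : ℝ) : MeasurableSet {w : EuclideanSpace ℝ (Fin 2) | t ^ 2 + ‖w‖ ^ 2 < ϱ ^ 2} :=
  measurableSet_lt (by fun_prop) measurable_const

/-- **Area of the slice**: `|{w : t² + |w|² < ϱ²}| = π (ϱ² − t²)` for `t² < ϱ²`. [folklore] -/
theorem volume_sliceSet_toReal {ϱ t : ℝ} (ht : t ^ 2 < ϱ ^ 2) :
    (volume {w : EuclideanSpace ℝ (Fin 2) | t ^ 2 + ‖w‖ ^ 2 < ϱ ^ 2}).toReal = Real.pi * (ϱ ^ 2 - t ^ 2) := by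
  rw [sliceSet_eq_ball, EuclideanSpace.volume_ball_fin_two, ENNReal.toReal_mul,
    ← ENNReal.ofReal_pow (Real.sqrt_nonneg _), ENNReal.toReal_ofReal (by positivity),
    ENNReal.toReal_ofReal Real.pi_pos.le, Real.sq_sqrt (by linarith)]
  ring

/-- `t² < ϱ² ↔ t ∈ (-ϱ, ϱ)` for `ϱ ≥ 0`. [folklore] -/
theorem sq_lt_sq_iff_mem_Ioo {ϱ : ℝ} (hϱ : 0 ≤ ϱ) (t : ℝ) : t ^ 2 < ϱ ^ 2 ↔ t ∈ Ioo (-ϱ) ϱ := by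
  rw [sq_lt_sq, abs_of_nonneg hϱ, abs_lt, mem_Ioo]

end Slices

section BallIndicator

/-- Antiderivative for `∫ (ϱ² − t²) cos(κt) dt`. [folklore] -/
theorem hasDerivAt_ballSliceAntideriv (κ ϱ : ℝ) (hκ : κ ≠ 0) (t : ℝ) :
    HasDerivAt (fun t => (ϱ ^ 2 - t ^ 2) * Real.sin (κ * t) / κ - 2 * t * Real.cos (κ * t) / κ ^ 2 +
        2 * Real.sin (κ * t) / κ ^ 3) ((ϱ ^ 2 - t ^ 2) * Real.cos (κ * t)) t := by
  have hd : DifferentiableAt ℝ (fun t => (ϱ ^ 2 - t ^ 2) * Real.sin (κ * t) / κ -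
      2 * t * Real.cos (κ * t) / κ ^ 2 + 2 * Real.sin (κ * t) / κ ^ 3) t := by fun_prop
  refine hd.hasDerivAt.congr_deriv ?_
  have h : deriv (fun t => (ϱ ^ 2 - t ^ 2) * Real.sin (κ * t) / κ -
      2 * t * Real.cos (κ * t) / κ ^ 2 + 2 * Real.sin (κ * t) / κ ^ 3) t =
      (ϱ ^ 2 - t ^ 2) * Real.cos (κ * t) := by
    simp (disch := fun_prop)
    field_simp
    ring
  exact h

/-- **Fourier transform of the ball indicator**:
`∫_{|y| < ϱ} cos(k·y) dy = 4π (sin x − x cos x)/|k|³`, `x = |k|ϱ` (`k ≠ 0`, `ϱ ≥ 0`).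
[folklore] -/
theorem integral_ball_cos_inner {k : Space} (hk : k ≠ 0) {ϱ : ℝ} (hϱ : 0 ≤ ϱ) :
    ∫ y in ball (0 : Space) ϱ, Real.cos ⟪k, y⟫ =
      4 * Real.pi * (Real.sin (‖k‖ * ϱ) - ‖k‖ * ϱ * Real.cos (‖k‖ * ϱ)) / ‖k‖ ^ 3 := by
  set κ : ℝ := ‖k‖ with hκ
  have hκ0 : κ ≠ 0 := by rw [hκ]; exact norm_ne_zero_iff.2 hk
  -- Step 1: rotate the phase to the axis
  have h1 : ∫ y in ball (0 : Space) ϱ, Real.cos ⟪k, y⟫ =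
      ∫ y in ball (0 : Space) ϱ, Real.cos (κ * y 0) :=
    setIntegral_ball_inner_eq k ϱ (fun a _ => Real.cos a)
  rw [h1]
  -- Step 2: the integrand as an indicator, Fubini along `e₀`
  set f : Space → ℝ := fun y => Real.cos (κ * y 0) with hf
  have hfc : Continuous f := Real.continuous_cos.comp (continuous_const.mul (PiLp.continuous_apply 2 _ 0))
  have hfi : Integrable ((ball (0 : Space) ϱ).indicator f) :=
    ((hfc.continuousOn.integrableOn_compact (isCompact_closedBall 0 ϱ)).mono_set
      ball_subset_closedBall).integrable_indicator measurableSet_ball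
  obtain ⟨e, he, hcoord⟩ := exists_slabEquiv
  rw [← integral_indicator measurableSet_ball, integral_eq_integral_integral_symm he hfi]
  -- Step 3: the slices
  have hslice : ∀ t : ℝ, ∫ w : EuclideanSpace ℝ (Fin 2), (ball (0 : Space) ϱ).indicator f (e.symm (t, w)) =
      (Ioo (-ϱ) ϱ).indicator (fun t => Real.cos (κ * t) * (Real.pi * (ϱ ^ 2 - t ^ 2))) t := by
    intro t
    have hpt : ∀ w : EuclideanSpace ℝ (Fin 2), (ball (0 : Space) ϱ).indicator f (e.symm (t, w)) =
        {w : EuclideanSpace ℝ (Fin 2) | t ^ 2 + ‖w‖ ^ 2 < ϱ ^ 2}.indicator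
          (fun _ => Real.cos (κ * t)) w := by
      intro w
      by_cases hw : t ^ 2 + ‖w‖ ^ 2 < ϱ ^ 2
      · rw [indicator_of_mem ((mem_ball_iff_of_norm_sq hϱ (hcoord t w).2).2 hw),
          indicator_of_mem (show w ∈ {w : EuclideanSpace ℝ (Fin 2) | t ^ 2 + ‖w‖ ^ 2 < ϱ ^ 2}
            from hw), hf]
        simp only [(hcoord t w).1]
      · rw [indicator_of_notMem (fun h => hw ((mem_ball_iff_of_norm_sq hϱ (hcoord t w).2).1 h)),
          indicator_of_notMem (show w ∉ {w : EuclideanSpace ℝ (Fin 2) | t ^ 2 + ‖w‖ ^ 2 < ϱ ^ 2}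
            from hw)]
    simp_rw [hpt]
    rw [integral_indicator_const _ (measurableSet_sliceSet ϱ t), smul_eq_mul, measureReal_def]
    by_cases ht : t ^ 2 < ϱ ^ 2
    · rw [volume_sliceSet_toReal ht, indicator_of_mem ((sq_lt_sq_iff_mem_Ioo hϱ t).1 ht), mul_comm]
    · rw [sliceSet_eq_empty (not_lt.1 ht), measure_empty, ENNReal.toReal_zero, zero_mul,
        indicator_of_notMem (fun h => ht ((sq_lt_sq_iff_mem_Ioo hϱ t).2 h))]
  simp_rw [hslice]
  -- Step 4: one-variable calculus
  rw [integral_indicator measurableSet_Ioo, ← integral_Ioc_eq_integral_Ioo,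
    ← intervalIntegral.integral_of_le (by linarith : -ϱ ≤ ϱ)]
  have hderiv := fun t (_ : t ∈ uIcc (-ϱ) ϱ) => hasDerivAt_ballSliceAntideriv κ ϱ hκ0 t
  have hint : IntervalIntegrable (fun t => (ϱ ^ 2 - t ^ 2) * Real.cos (κ * t)) volume (-ϱ) ϱ :=
    (Continuous.intervalIntegrable (by fun_prop) _ _)
  have hFTC := intervalIntegral.integral_eq_sub_of_hasDerivAt hderiv hint
  have hrw : (fun t => Real.cos (κ * t) * (Real.pi * (ϱ ^ 2 - t ^ 2))) =
      fun t => Real.pi * ((ϱ ^ 2 - t ^ 2) * Real.cos (κ * t)) := by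
    funext t; ring
  rw [hrw, intervalIntegral.integral_const_mul, hFTC]
  simp only [mul_neg, Real.sin_neg, Real.cos_neg, neg_sq, sub_self, zero_mul, zero_div]
  field_simp
  ring

end BallIndicator

end Summit.AtomisticToContinuum.BoseEinsteinCondensation.Theorems.SubharmonicContinuation

end
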